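import Summits.Ventures.DiscreteObjects.Hadamard.Order6TypeI
import Summits.Ventures.DiscreteObjects.Hadamard.Order6Nega

/-!
# H(4q), q ≡ 11 (mod 12) prime: EVERY AUTOMORPHISM g WITH g⁶ = 1 HAS AN EVEN NUMBER OF 6-CYCLES (kernel; 668 and 716)

Framing: lottery ticket; floor = certified bounds/negative ranges.

Cell pub-namedobj (venture DiscreteObjects), target (H), hadamard gen 14.  Assembly of the order-6 analysis: for a signed
automorphism `g = (π, κ, d, e)` of a Hadamard matrix of order `4q`, `q ≡ 11 (mod 12)` prime, with `π⁶ = κ⁶ = 1` (pointwise),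
the cube `g³ = (π³, κ³, d·d∘π·d∘π², …)` is either trivial on rows and columns (then there are no `6`-cycles), or — by the
involution census `hadamard4q_involution_census` (gen 13) — NEGA fixed-point-free (then `hadamard4q_aut_order6_cube_fpf`,
the `√3`-eigenspace folding) or of TYPE I with a common sign `δ` on its fixed points (then, after passing to `−g` when
`δ = −1`, `hadamard4q_six_typeI`, the eigenvalue-`1` folding).  In every case:
**`hadamard4q_aut_order6_even_six_cycles`**: `12 ∣ #{i | π² i ≠ i ∧ π³ i ≠ i}` and `12 ∣ #{j | κ² j ≠ j ∧ κ³ j ≠ j}` — the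
number of `6`-cycles of `π` and of `κ` is EVEN.  Instances `hadamard668_aut_order6_even_six_cycles`,
`hadamard716_aut_order6_even_six_cycles`.  What it does NOT say: no order is excluded; `3`-cycles, `2`-cycles and fixed
points are unconstrained beyond the earlier census.  Ours; no `sorry`.
-/

namespace Summit.Ventures.DiscreteObjects.Hadamard

open Finset BigOperators Matrix

open Literature.Combinatorics.Designs.GoethalsSeidel (IsHadamardMatrix)

section final6
variable {ι : Type*} [Fintype ι] [DecidableEq ι]

/-- **Rows**: for a signed automorphism with `π⁶ = κ⁶ = 1` of an H(4q), `q ≡ 11 (mod 12)` prime, the number of rows on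
`6`-cycles of `π` is divisible by `12`. -/
theorem hadamard4q_order6_six_rows {q : ℕ} (hq : q.Prime) (hq12 : q % 12 = 11) {H : Matrix ι ι ℤ}
    (hH : IsHadamardMatrix H) (hι : Fintype.card ι = 4 * q) {π κ : Equiv.Perm ι} {d e : ι → ℤ}
    (haut : IsSignedAut H π κ d e)
    (hπ6 : ∀ i, π (π (π (π (π (π i))))) = i) (hκ6 : ∀ j, κ (κ (κ (κ (κ (κ j))))) = j) :
    12 ∣ (univ.filter (fun i => π (π i) ≠ i ∧ π (π (π i)) ≠ i)).card := by
  have hd := haut.1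
  have he := haut.2.1
  have hA := haut.2.2
  have pm_mul : ∀ {a b : ℤ}, (a = 1 ∨ a = -1) → (b = 1 ∨ b = -1) → (a * b = 1 ∨ a * b = -1) := by
    intro a b ha hb
    rcases ha with h | h <;> rcases hb with h' | h' <;> simp [h, h']
  have hq4 : q % 4 = 3 := by omega
  -- the cube
  have haut3 : IsSignedAut H (π ^ 3) (κ ^ 3) (fun i => d i * d (π i) * d (π (π i)))
      (fun j => e j * e (κ j) * e (κ (κ j))) := by
    refine ⟨fun i => pm_mul (pm_mul (hd i) (hd (π i))) (hd (π (π i))),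
      fun j => pm_mul (pm_mul (he j) (he (κ j))) (he (κ (κ j))), fun i j => ?_⟩
    have p3π : (π ^ 3) i = π (π (π i)) := by simp [pow_succ]
    have p3κ : (κ ^ 3) j = κ (κ (κ j)) := by simp [pow_succ]
    rw [p3π, p3κ, hA, hA, hA]
    ring
  have p3π : ∀ i, (π ^ 3) i = π (π (π i)) := fun i => by simp [pow_succ]
  have p3κ : ∀ j, (κ ^ 3) j = κ (κ (κ j)) := fun j => by simp [pow_succ]
  by_cases htriv : π ^ 3 = 1 ∧ κ ^ 3 = 1
  · -- no 6-cycles at all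
    have hempty : univ.filter (fun i => π (π i) ≠ i ∧ π (π (π i)) ≠ i) = ∅ := by
      apply Finset.filter_eq_empty_iff.mpr
      intro i _ h
      apply h.2
      have := congrArg (fun τ : Equiv.Perm ι => τ i) htriv.1
      simpa [pow_succ] using this
    rw [hempty, Finset.card_empty]
    exact dvd_zero 12
  · have hne : π ^ 3 ≠ 1 ∨ κ ^ 3 ≠ 1 := by
      rw [← not_and_or]; exact htriv
    have hsqπ : (π ^ 3) ^ 2 = 1 := by ext i; simp [pow_succ, hπ6]
    have hsqκ : (κ ^ 3) ^ 2 = 1 := by ext j; simp [pow_succ, hκ6]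
    obtain ⟨-, -, hcases⟩ := hadamard4q_involution_census hq4 hH hι (π ^ 3) (κ ^ 3) _ _ haut3 hsqπ hsqκ hne
    rcases hcases with ⟨hff, -, h4, -, δ, hδ, hδr, hδc⟩ | ⟨hf0, hg0, -, -⟩
    · -- TYPE I cube
      have hπ3inv : ∀ i, (π ^ 3) ((π ^ 3) i) = i := fun i => by simp [pow_succ, hπ6]
      have hκ3inv : ∀ j, (κ ^ 3) ((κ ^ 3) j) = j := fun j => by simp [pow_succ, hκ6]
      have hsq := signedAut_sq_sign hH.1 haut3 hπ3inv hκ3inv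
      -- a fixed row and a fixed column of the cube exist (f ≥ 4)
      obtain ⟨i₀, hi₀⟩ : ∃ i, (π ^ 3) i = i := by
        by_contra h
        push Not at h
        have h0 : (univ.filter fun i => (π ^ 3) i = i).card = 0 := by
          rw [Finset.card_eq_zero, Finset.filter_eq_empty_iff]; intro i _; exact h i
        omega
      obtain ⟨j₀, hj₀⟩ : ∃ j, (κ ^ 3) j = j := by
        by_contra h
        push Not at h
        have h0 : (univ.filter fun j => (κ ^ 3) j = j).card = 0 := by
          rw [Finset.card_eq_zero, Finset.filter_eq_empty_iff]; intro j _; exact h j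
        omega
      -- sign type ε = +1: all six-products are 1
      have hd6 : ∀ i, d i * d (π i) * d (π (π i)) * d (π (π (π i))) * d (π (π (π (π i)))) *
          d (π (π (π (π (π i))))) = 1 := by
        intro i
        have h := hsq i j₀
        rw [hj₀, pm_mul_self (haut3.2.1 j₀), mul_one] at h
        simp only [p3π] at h
        linear_combination h
      have he6 : ∀ j, e j * e (κ j) * e (κ (κ j)) * e (κ (κ (κ j))) * e (κ (κ (κ (κ j)))) *
          e (κ (κ (κ (κ (κ j))))) = 1 := by
        intro j
        have h := hsq i₀ j
        rw [hi₀, pm_mul_self (haut3.1 i₀), one_mul] at h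
        simp only [p3κ] at h
        linear_combination h
      have hd2 : ∀ i, π (π i) = i → d i * d (π i) = 1 := by
        intro i h2
        have h := hd6 i
        rw [h2, h2] at h
        rcases hd i with a | a <;> rcases hd (π i) with b | b <;> simp [a, b] at h ⊢
      have he2 : ∀ j, κ (κ j) = j → e j * e (κ j) = 1 := by
        intro j h2
        have h := he6 j
        rw [h2, h2] at h
        rcases he j with a | a <;> rcases he (κ j) with b | b <;> simp [a, b] at h ⊢
      rcases hδ with hδ1 | hδ1
      · subst hδ1
        have hd3 : ∀ i, π (π (π i)) = i → d i * d (π i) * d (π (π i)) = 1 :=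
          fun i h3 => hδr i (by rw [p3π]; exact h3)
        have he3 : ∀ j, κ (κ (κ j)) = j → e j * e (κ j) * e (κ (κ j)) = 1 :=
          fun j h3 => hδc j (by rw [p3κ]; exact h3)
        exact hadamard4q_six_typeI hq hq12 hH hι haut hπ6 hκ6 hd6 hd2 hd3 he6 he2 he3
      · subst hδ1
        -- pass to −g
        have haut' : IsSignedAut H π κ (fun i => -d i) (fun j => -e j) := by
          refine ⟨fun i => ?_, fun j => ?_, fun i j => ?_⟩
          · rcases hd i with h | h <;> simp [h]
          · rcases he j with h | h <;> simp [h]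
          · rw [hA]; ring
        have hd6' : ∀ i, (-d i) * (-d (π i)) * (-d (π (π i))) * (-d (π (π (π i)))) * (-d (π (π (π (π i))))) *
            (-d (π (π (π (π (π i)))))) = 1 := fun i => by have := hd6 i; linear_combination this
        have he6' : ∀ j, (-e j) * (-e (κ j)) * (-e (κ (κ j))) * (-e (κ (κ (κ j)))) * (-e (κ (κ (κ (κ j))))) *
            (-e (κ (κ (κ (κ (κ j)))))) = 1 := fun j => by have := he6 j; linear_combination this
        have hd2' : ∀ i, π (π i) = i → (-d i) * (-d (π i)) = 1 :=
          fun i h2 => by have := hd2 i h2; linear_combination this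
        have he2' : ∀ j, κ (κ j) = j → (-e j) * (-e (κ j)) = 1 :=
          fun j h2 => by have := he2 j h2; linear_combination this
        have hd3' : ∀ i, π (π (π i)) = i → (-d i) * (-d (π i)) * (-d (π (π i))) = 1 := by
          intro i h3
          have := hδr i (by rw [p3π]; exact h3)
          linear_combination -this
        have he3' : ∀ j, κ (κ (κ j)) = j → (-e j) * (-e (κ j)) * (-e (κ (κ j))) = 1 := by
          intro j h3
          have := hδc j (by rw [p3κ]; exact h3)
          linear_combination -this
        exact hadamard4q_six_typeI hq hq12 hH hι haut' hπ6 hκ6 hd6' hd2' hd3' he6' he2' he3'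
    · -- NEGA cube: π³, κ³ fixed-point-free
      have hπ3f : ∀ i, π (π (π i)) ≠ i := by
        intro i h
        have hmem : i ∈ univ.filter (fun i => (π ^ 3) i = i) := mem_filter.mpr ⟨mem_univ _, by rw [p3π]; exact h⟩
        rw [Finset.card_eq_zero] at hf0
        rw [hf0] at hmem
        exact absurd hmem (Finset.notMem_empty _)
      have hκ3f : ∀ j, κ (κ (κ j)) ≠ j := by
        intro j h
        have hmem : j ∈ univ.filter (fun j => (κ ^ 3) j = j) := mem_filter.mpr ⟨mem_univ _, by rw [p3κ]; exact h⟩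
        rw [Finset.card_eq_zero] at hg0
        rw [hg0] at hmem
        exact absurd hmem (Finset.notMem_empty _)
      have h12 := (hadamard4q_aut_order6_cube_fpf hq hq12 hH hι haut hπ6 hκ6 hπ3f hκ3f).1
      have hset : univ.filter (fun i => π (π i) ≠ i ∧ π (π (π i)) ≠ i) = univ.filter (fun i => π (π i) ≠ i) := by
        ext i
        simp only [mem_filter, mem_univ, true_and]
        exact ⟨fun h => h.1, fun h => ⟨h, hπ3f i⟩⟩
      rw [hset]
      exact h12

/-- **H(4q), `q ≡ 11 (mod 12)` prime: every signed automorphism `g` with `g⁶ = 1` has an even number of 6-cycles, on rows and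
on columns** (`12 ∣ #{i | π² i ≠ i ∧ π³ i ≠ i}`, `12 ∣ #{j | κ² j ≠ j ∧ κ³ j ≠ j}`).  Covers the open orders `668` and
`716`. -/
theorem hadamard4q_aut_order6_even_six_cycles {q : ℕ} (hq : q.Prime) (hq12 : q % 12 = 11) {H : Matrix ι ι ℤ}
    (hH : IsHadamardMatrix H) (hι : Fintype.card ι = 4 * q) {π κ : Equiv.Perm ι} {d e : ι → ℤ}
    (haut : IsSignedAut H π κ d e)
    (hπ6 : ∀ i, π (π (π (π (π (π i))))) = i) (hκ6 : ∀ j, κ (κ (κ (κ (κ (κ j))))) = j) :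
    12 ∣ (univ.filter (fun i => π (π i) ≠ i ∧ π (π (π i)) ≠ i)).card ∧
      12 ∣ (univ.filter (fun j => κ (κ j) ≠ j ∧ κ (κ (κ j)) ≠ j)).card := by
  have hcardι : (Fintype.card ι : ℤ) ≠ 0 := by rw [hι]; push_cast; have := hq.pos; positivity
  exact ⟨hadamard4q_order6_six_rows hq hq12 hH hι haut hπ6 hκ6,
    hadamard4q_order6_six_rows hq hq12 (isHadamard_transpose hH hcardι) hι (isSignedAut_transpose haut) hκ6 hπ6⟩

/-- **H(668) instance**: every signed automorphism `g` of a Hadamard matrix of order `668` with `g⁶ = 1` (pointwise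
`π⁶ = κ⁶ = 1`) has an even number of `6`-cycles on rows and on columns. -/
theorem hadamard668_aut_order6_even_six_cycles {H : Matrix ι ι ℤ} (hH : IsHadamardMatrix H)
    (hι : Fintype.card ι = 668) {π κ : Equiv.Perm ι} {d e : ι → ℤ} (haut : IsSignedAut H π κ d e)
    (hπ6 : ∀ i, π (π (π (π (π (π i))))) = i) (hκ6 : ∀ j, κ (κ (κ (κ (κ (κ j))))) = j) :
    12 ∣ (univ.filter (fun i => π (π i) ≠ i ∧ π (π (π i)) ≠ i)).card ∧
      12 ∣ (univ.filter (fun j => κ (κ j) ≠ j ∧ κ (κ (κ j)) ≠ j)).card :=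
  hadamard4q_aut_order6_even_six_cycles (q := 167) (by norm_num) (by norm_num) hH (by rw [hι]) haut hπ6 hκ6

/-- **H(716) instance** (`716 = 4·179`, `179 ≡ 11 (mod 12)`). -/
theorem hadamard716_aut_order6_even_six_cycles {H : Matrix ι ι ℤ} (hH : IsHadamardMatrix H)
    (hι : Fintype.card ι = 716) {π κ : Equiv.Perm ι} {d e : ι → ℤ} (haut : IsSignedAut H π κ d e)
    (hπ6 : ∀ i, π (π (π (π (π (π i))))) = i) (hκ6 : ∀ j, κ (κ (κ (κ (κ (κ j))))) = j) :
    12 ∣ (univ.filter (fun i => π (π i) ≠ i ∧ π (π (π i)) ≠ i)).card ∧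
      12 ∣ (univ.filter (fun j => κ (κ j) ≠ j ∧ κ (κ (κ j)) ≠ j)).card :=
  hadamard4q_aut_order6_even_six_cycles (q := 179) (by norm_num) (by norm_num) hH (by rw [hι]) haut hπ6 hκ6

end final6

end Summit.Ventures.DiscreteObjects.Hadamard
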